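/-
Copyright (c) 2026 the pub-hodgecm-mathlib formalisation cell (harness21).  Prover seat hodgecm-mathlib-LH10-p01 (g10): road M6 «ROW 2 ★ DYADIC TWIN» ∕ F3 «TOT-Λ BY OVER-ORDERS»
(LEAD F0P3a-plan T14-66), dealer LH4-plan (g8) WORD #76 rider (r1) — the level-`b` unit-norm surjectivity `N(U_E^{(b)}) = U_F^{(b)}` at an inert place, binder `hnormEb` of
LH4-p01 (g9)'s F3-3 `GluedOverOrderUnitaryGenerator`; 2026-09-02∕03.
-/
import Literature.NumberTheory.LocalFields.UnramifiedQuadraticNormAtInertPlace     -- ★ `exists_mul_galAdicCompletionMap_eq_of_inert` (level 0) + the inert-place dictionary; brings ★ `UnramifiedQuadraticNormSurjective` (`exists_mul_map_eq_of_sub_one_mem`, `map_mem_maximalIdeal`)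
import Literature.NumberTheory.LocalFields.UnramifiedQuadraticNormSemilocal        -- ★ `exists_add_map_eq_one_of_isUnit_sub'` (trace-one element from a unit-moved integer)
import Literature.NumberTheory.Automorphic.SplitTorusOrderFixedSidePlace           -- ★ Σ2-CM `exists_isUnit_galAdicCompletionMap_sub` (`σ_w` moves an integer by a unit at an inert-unramified place)
import HarnessLib

/-!
# `N(U_E^{(b)}) = U_F^{(b)}`: unit-norm surjectivity AT LEVEL `b` for an unramified quadratic extension, at an inert place (no `|2| = 1`)

Topic `NumberTheory/LocalFields`; namespace `Literature.NumberTheory.LocalFields.UnramifiedQuadraticNorm`.  THEOREMS ONLY (no definition, no instance, no notation, no named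
fact, no `sorry`); kernel lane `--supports stmt-HodgeConjecture-24833`.  Cell `pub/hodgecm-mathlib` (D-0151), crux H413; road M6 ∕ F3 «TOT-Λ by over-orders» (dealer LH4-plan (g8)
WORD #76, rider (r1)): the binder `hnormEb : ∀ r : 𝒪, σO r = r → r − 1 ∈ span{ϖ^b} → ∃ w, w − 1 ∈ span{ϖ^b} ∧ w * σO w = r` of LH4-p01 (g9)'s F3-3 `GluedOverOrderUnitaryGenerator`
(SIG-F3-3 §1), DISCHARGED at the inert place.  The Hensel∕filtration content is ★ already — ★ `UnramifiedQuadraticNormSurjective.exists_mul_map_eq_of_sub_one_mem` (Serre V §2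
Prop. 3 a): for ANY ideal `I` with `R` `I`-adically complete, `σ(I) ⊆ I`, trace hitting `1`, every `σ`-fixed `u ≡ 1 (I)` is `s·σ s` with `s ≡ 1 (I)`); this file only supplies
(§1) the completeness of the valuation ring `𝒪[E]` of a non-archimedean local field for EVERY ideal `J ≤ 𝓂[E]` (Mathlib's compactness proof of `IsAdicComplete 𝓂[K] 𝒪[K]`
run with `J^n`: all ideals of `𝒪` are closed, `𝒪` is compact; separatedness from `J^n ≤ 𝓂^n`), (§1) the generic level-`J` head over `𝒪[E]` with an involution `σ` preserving `𝒪`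
and moving some integer by a unit (unramified), and (§2) the reading at an INERT place `w ∣ v` of a quadratic extension of number fields with `J := span{ϖ^b} = 𝓂^b`, `ϖ` ANY
uniformiser of `𝒪[E_w]`, `1 ≤ b`: **`∀ u : 𝒪[E_w], σ_w u = u → u − 1 ∈ span{ϖ^b} → ∃ s, s − 1 ∈ span{ϖ^b} ∧ s·σ_w s = u`** — `hnormEb` token for token.  Any residue
characteristic; no `|2| = 1`.
HONEST LABEL: HC_CM is proved only modulo the 7 printed citations (2 remaining named inputs: hLiu418 = stmt-HodgeConjecture-24832, h413 = stmt-HodgeConjecture-24833) until rung 0 closes;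
unconditional local algebra, count-neutral (zero label movement until F5 ★ + a desk-priced rider).

* §1 `isAdicComplete_of_le_maximalIdeal`, **`exists_sub_one_mem_and_mul_map_eq_of_le_maximalIdeal`**.
* §2 `map_pow_maximalIdeal_le`, **`exists_sub_one_mem_span_pow_and_mul_galAdicCompletionMap_eq`**.

## References
* [Serre1979] J.-P. Serre, *Local Fields*, GTM 67 (1979): Ch. V §2 Prop. 3 (a) «`N(U_L^n) = U_K^n` for unramified `L/K`», Corollary; Ch. II §1 (completeness of `𝒪`).
* [Kottwitz1986] R. E. Kottwitz, *Stable trace formula: elliptic singular terms*, Math. Ann. 275 (1986): §7, proof of Prop. 7.1 (unit norms in the commutant order).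
-/

set_option autoImplicit false

noncomputable section

open ValuativeRel NumberField IsDedekindDomain
open Literature.NumberTheory.LocalFields.UnramifiedQuadraticNorm Literature.NumberTheory.Automorphic

namespace Literature.NumberTheory.LocalFields.UnramifiedQuadraticNorm

/-! ## §1 The valuation ring of a non-archimedean local field is `J`-adically complete for every ideal `J ≤ 𝓂`; the level-`J` unit-norm surjectivity -/

section LocalField

variable {E : Type*} [Field E] [ValuativeRel E] [UniformSpace E] [IsUniformAddGroup E] [IsNonarchimedeanLocalField E]

open scoped Pointwise in
/-- **`𝒪[E]` is `J`-adically complete for every ideal `J ≤ 𝓂[E]`** (`E` a non-archimedean local field): Mathlib's proof of `IsAdicComplete 𝓂[E] 𝒪[E]` verbatim with `J^n` —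
the cosets `f n + J^n` are closed (every ideal of the Noetherian compact ring `𝒪[E]` is closed) and nested, so they meet (`𝒪[E]` compact); separatedness because `J^n ≤ 𝓂^n` and
`𝒪[E]` is `𝓂`-adically separated.  (For `J = 𝓂^b` this is the `𝓂^b`-adic = `𝓂`-adic completeness.) [cite: Serre1979, Ch. II §1] -/
theorem isAdicComplete_of_le_maximalIdeal (J : Ideal 𝒪[E]) (hJ : J ≤ 𝓂[E]) : IsAdicComplete J 𝒪[E] where
  haus' x hx := by
    refine IsHausdorff.haus (inferInstance : IsAdicComplete 𝓂[E] 𝒪[E]).toIsHausdorff x fun n => ?_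
    exact SModEq.mono (Submodule.smul_mono_left (Ideal.pow_right_mono hJ n)) (hx n)
  prec' f hf := by
    let S n : Set 𝒪[E] := f n +ᵥ ((J ^ n : Ideal 𝒪[E]) : Set 𝒪[E])
    have hS n : S (n + 1) ⊆ S n := by
      apply (Set.vadd_set_subset_vadd_set_iff.mpr (Ideal.pow_le_pow_right n.le_succ)).trans
      simpa [S] using (hf n.le_succ).symm
    have h n : IsClosed (S n) := (IsNoetherianRing.isClosed_ideal (J ^ n)).vadd (f n)
    obtain ⟨L, hL⟩ := (h 0).isCompact.nonempty_iInter_of_sequence_nonempty_isCompact_isClosed S hS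
      (by simp [S]) h
    refine ⟨L, fun n ↦ ?_⟩
    obtain ⟨y, hy, rfl⟩ := Set.mem_iInter.mp hL n
    simpa [SModEq.sub_mem] using hy

variable (σ : E →+* E)

/-- **`N(U_E^{(J)}) = U_F^{(J)}` over the valuation ring of a non-archimedean local field.**  `σ` an involution of `E` preserving `𝒪 = 𝒪[E]`, MOVING SOME INTEGER BY A UNIT
(`hmove` — the unramified case: the trace then hits `1`, ★ `exists_add_map_eq_one_of_isUnit_sub'`); `J ≤ 𝓂` a `σ`-stable ideal.  Then every `σ`-fixed `u ∈ 𝒪` with `u ≡ 1 (mod J)`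
is a norm `s · σ s` with `s ≡ 1 (mod J)` — ★ `exists_mul_map_eq_of_sub_one_mem` at `R := 𝒪[E]`, `I := J` (complete by `isAdicComplete_of_le_maximalIdeal`).
[cite: Serre1979, Ch. V §2 Prop. 3] -/
theorem exists_sub_one_mem_and_mul_map_eq_of_le_maximalIdeal (hσσ : ∀ x, σ (σ x) = x) (hσO : ∀ x : 𝒪[E], σ x ∈ 𝒪[E])
    (hmove : ∃ a : 𝒪[E], IsUnit ((⟨σ a, hσO a⟩ : 𝒪[E]) - a)) (J : Ideal 𝒪[E]) (hJ : J ≤ 𝓂[E])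
    (hσJ : ∀ a : 𝒪[E], a ∈ J → (⟨σ a, hσO a⟩ : 𝒪[E]) ∈ J) (u : 𝒪[E]) (hσu : σ u = u) (hu1 : u - 1 ∈ J) :
    ∃ s : 𝒪[E], s - 1 ∈ J ∧ (s : E) * σ s = u := by
  let σO : 𝒪[E] →+* 𝒪[E] := (σ.comp (𝒪[E]).subtype).codRestrict 𝒪[E] fun x => hσO x
  have hσOσ : ∀ a : 𝒪[E], σO (σO a) = a := fun a => Subtype.ext (hσσ a)
  obtain ⟨a, ha⟩ := hmove
  have ha' : IsUnit (σO a - a) := ha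
  obtain ⟨t, ht⟩ := exists_add_map_eq_one_of_isUnit_sub' σO hσOσ ha'
  have hσOJ : ∀ x ∈ J, σO x ∈ J := fun x hx => hσJ x hx
  have hσOu : σO u = u := Subtype.ext hσu
  haveI : IsAdicComplete J 𝒪[E] := isAdicComplete_of_le_maximalIdeal J hJ
  obtain ⟨s, hs, hs1⟩ := exists_mul_map_eq_of_sub_one_mem σO hσOσ hσOJ ht hσOu hu1
  exact ⟨s, hs1, by rw [← hs]; rfl⟩

end LocalField

/-! ## §2 At an INERT place of a quadratic extension of number fields: `hnormEb` at level `span{ϖ^b} = 𝓂^b` -/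

section InertPlace

variable {F E : Type} [Field F] [NumberField F] [Field E] [NumberField E] [Algebra F E]
  [Algebra.IsQuadraticExtension F E] (c : E ≃ₐ[F] E) (v : HeightOneSpectrum (𝓞 F))

omit [NumberField F] [Algebra.IsQuadraticExtension F E] in
/-- `σ_w` maps `𝓂^b` into itself (`σ_w` is an involution preserving `𝒪[E_w]`, hence preserving `𝓂`, ★ `map_mem_maximalIdeal`; then `Ideal.map_pow`). [cite: Serre1979, Ch. V §1] -/
theorem map_pow_maximalIdeal_le (hcc : c * c = 1) (w : UnitaryGroup.PlacesOver E v) (hw : c • w.1 = w.1)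
    (σO : 𝒪[w.1.adicCompletion E] →+* 𝒪[w.1.adicCompletion E])
    (hσO : ∀ x : 𝒪[w.1.adicCompletion E], ((σO x : 𝒪[w.1.adicCompletion E]) : w.1.adicCompletion E) = galAdicCompletionMap (L := E) c hw x) (b : ℕ) :
    (𝓂[w.1.adicCompletion E] ^ b).map σO ≤ 𝓂[w.1.adicCompletion E] ^ b := by
  have hσσ : ∀ x, σO (σO x) = x := fun x => Subtype.ext (by
    rw [hσO, hσO]; exact Literature.NumberTheory.Automorphic.Liu2021.galAdicCompletionMap_galAdicCompletionMap_self F E c hcc hw x)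
  have h1 : (𝓂[w.1.adicCompletion E]).map σO ≤ 𝓂[w.1.adicCompletion E] :=
    Ideal.map_le_iff_le_comap.2 fun x hx => map_mem_maximalIdeal σO hσσ x hx
  rw [Ideal.map_pow]
  exact Ideal.pow_right_mono h1 b

/-- **`hnormEb` AT AN INERT PLACE: `N(U_{E_w}^{(b)}) = U_{F_v}^{(b)}`, any residue characteristic.**  `E/F` quadratic number fields, `c ≠ 1`, `c² = 1`, `v` unramified in `E`,
`w ∣ v` with `c • w = w`, `σ_w` the conjugation of `E_w` restricted to `𝒪 = 𝒪[E_w]` (`σO`), `ϖ` ANY uniformiser of `𝒪` (`Irreducible ϖ`), `1 ≤ b`: every `σ_w`-fixed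
`u ∈ 𝒪` with `u − 1 ∈ (ϖ^b)` is `s · σ_w s` for some `s` with `s − 1 ∈ (ϖ^b)`.  (§1 at `J := span{ϖ^b} = 𝓂^b`; `hmove` is ★ Σ2-CM `exists_isUnit_galAdicCompletionMap_sub`;
level `b = 0` is ★ `exists_mul_galAdicCompletionMap_eq_of_inert`.) [cite: Serre1979, Ch. V §2 Prop. 3] [cite: Kottwitz1986, §7 proof of Prop. 7.1] -/
theorem exists_sub_one_mem_span_pow_and_mul_map_eq (hc : c ≠ 1) (hcc : c * c = 1) (hv : Algebra.IsUnramifiedIn (𝓞 E) v.asIdeal)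
    (w : UnitaryGroup.PlacesOver E v) (hw : c • w.1 = w.1)
    (σO : 𝒪[w.1.adicCompletion E] →+* 𝒪[w.1.adicCompletion E])
    (hσO : ∀ x : 𝒪[w.1.adicCompletion E], ((σO x : 𝒪[w.1.adicCompletion E]) : w.1.adicCompletion E) = galAdicCompletionMap (L := E) c hw x)
    {ϖ : 𝒪[w.1.adicCompletion E]} (hϖ : Irreducible ϖ) {b : ℕ} (hb : 1 ≤ b) :
    ∀ u : 𝒪[w.1.adicCompletion E], σO u = u → u - 1 ∈ Ideal.span {ϖ ^ b} →
      ∃ s : 𝒪[w.1.adicCompletion E], s - 1 ∈ Ideal.span {ϖ ^ b} ∧ s * σO s = u := by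
  intro u hσu hu1
  have hspan : Ideal.span {ϖ ^ b} = 𝓂[w.1.adicCompletion E] ^ b := by
    rw [← Ideal.span_singleton_pow, ← hϖ.maximalIdeal_eq]
  have hJ : Ideal.span {ϖ ^ b} ≤ 𝓂[w.1.adicCompletion E] := by
    rw [hspan]
    exact Ideal.pow_le_self (by omega)
  have hσOmem : ∀ x : 𝒪[w.1.adicCompletion E], galAdicCompletionMap (L := E) c hw x ∈ 𝒪[w.1.adicCompletion E] :=
    mem_integer_galAdicCompletionMap c v w hw
  have hσOeq : ∀ x : 𝒪[w.1.adicCompletion E], (⟨galAdicCompletionMap (L := E) c hw x, hσOmem x⟩ : 𝒪[w.1.adicCompletion E]) = σO x :=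
    fun x => Subtype.ext (by rw [hσO])
  have hσJ : ∀ a : 𝒪[w.1.adicCompletion E], a ∈ Ideal.span {ϖ ^ b} → (⟨galAdicCompletionMap (L := E) c hw a, hσOmem a⟩ : 𝒪[w.1.adicCompletion E]) ∈ Ideal.span {ϖ ^ b} := by
    intro a ha
    rw [hσOeq, hspan]
    rw [hspan] at ha
    exact map_pow_maximalIdeal_le c v hcc w hw σO hσO b (Ideal.mem_map_of_mem σO ha)
  obtain ⟨a, ha⟩ := exists_isUnit_galAdicCompletionMap_sub c v hc hv w hw
  have hσu' : galAdicCompletionMap (L := E) c hw u = u := by rw [← hσO, hσu]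
  obtain ⟨s, hs1, hs⟩ := exists_sub_one_mem_and_mul_map_eq_of_le_maximalIdeal (galAdicCompletionMap (L := E) c hw)
    (Literature.NumberTheory.Automorphic.Liu2021.galAdicCompletionMap_galAdicCompletionMap_self F E c hcc hw) hσOmem ⟨a, ha⟩ _ hJ hσJ u hσu' hu1
  refine ⟨s, hs1, Subtype.ext ?_⟩
  rw [Subring.coe_mul, hσO]
  exact hs

end InertPlace

end Literature.NumberTheory.LocalFields.UnramifiedQuadraticNorm

end
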